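import Summits.ValiantsHypothesis.ValiantsHypothesis.Theorems.MonotoneRestorationOrbitRestorationQPGoodScale
import HarnessLib

/-!
# The matching lemma of the bounded-fan-in Structure Theorem (abstract form, XXIV)

Route MonotoneRestoration, crux `OrbitRestorationQP` (stmt-ValiantsHypothesis-18293), line `depth-three-rung`, registered stub
`stub_sigmaPiSigmaKValue` (A_k).  Namespace `Summit.ValiantsHypothesis.ValiantsHypothesis.Theorems.RankClustering`.  Route-independent.

Layer L3b of the Structure Theorem (crux workfile `Lines/depth-three-rung-stubA-bounded-fanin.md` §2(b), §9).  ABSTRACT SETTING: a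
finite index type `ι` of terms, DOUBLED (`ι ⊕ ι`: originals `inl i` = the terms `T_i` of a minimal `ΣΠΣ(k)` representation of
`f`, translates `inr j` = the terms `σ·T_j`), signed values `w : ι ⊕ ι → M` in an additive commutative group (`w (inl i) = T_i`,
`w (inr j) = −σ·T_j`, so `Σ w = f − σ·f = 0`), and a pseudo-metric `Δ₂` on `ι ⊕ ι` (the rank distance) which is the SAME on
originals and on translates (`σ`-invariance).  Hypotheses: minimality of the representation (no nonempty set of originals, or of
translates, sums to zero), the RANK-BOUND CONSEQUENCE `RBC(R)`: inside every MINIMAL zero-sum subset of `ι ⊕ ι` all distances are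
`≤ R` (this is where the Saxena–Seshadhri rank bound enters in the application), and a GOOD scale `θ` for the originals (any two
originals at distance `≤ 2R + 2(k−1)θ` are linked at `θ`; exists by `RankClustering.exists_good_scale`).  CONCLUSION (`matching`):
there is `e : ι → ι` with `Σ_{i' linked to i} w (inl i') + Σ_{j linked to e i} w (inr j) = 0` for every `i`, `i ~ i' ↔ e i ~ e i'`,
and every translate is linked to some `e i`.  In the application: every `σ ∈ Stab(f)` permutes the multiset of cluster sums `{F_j}`.

Proof: decompose `ι ⊕ ι` into minimal zero-sum blocks (`exists_minZero_labels`); no block consists of originals only or of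
translates only (minimality); distances inside a block are `≤ R`; two originals whose blocks meet linked translates are at distance
`≤ 2R + (k−1)θ`, hence linked (goodness); so the blocks meeting a cluster of originals are exactly the blocks meeting one cluster of
translates, and summing them gives the identity.  No definitions; everything is proved. [folklore; cite: KarninShpilka2009,
SaxenaSeshadhri2013]
-/

-- `Summit.ValiantsHypothesis.ValiantsHypothesis.…` is the tree's single-conjunct layout (Sub = Summit).
set_option linter.dupNamespace false

open scoped Classical

namespace Summit.ValiantsHypothesis.ValiantsHypothesis.Theorems

namespace RankClustering

open Finset

variable {α : Type} {M : Type} [AddCommGroup M]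

/-! ### Minimal zero-sum blocks -/

/-- A nonempty zero-sum set contains a MINIMAL zero-sum subset (nonempty, zero-sum, no proper nonempty zero-sum subset). [folklore] -/
theorem exists_minZero_subset (w : α → M) {S : Finset α} (hS : S.Nonempty) (h0 : ∑ x ∈ S, w x = 0) :
    ∃ B ⊆ S, B.Nonempty ∧ ∑ x ∈ B, w x = 0 ∧ ∀ B' ⊂ B, B'.Nonempty → ∑ x ∈ B', w x ≠ 0 := by
  set 𝒵 : Finset (Finset α) := S.powerset.filter fun B => B.Nonempty ∧ ∑ x ∈ B, w x = 0 with h𝒵def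
  have h𝒵 : 𝒵.Nonempty := ⟨S, mem_filter.2 ⟨mem_powerset.2 Subset.rfl, hS, h0⟩⟩
  obtain ⟨B, hB, hmin⟩ := exists_min_image 𝒵 Finset.card h𝒵
  obtain ⟨hBS, hBne, hB0⟩ := mem_filter.1 hB
  refine ⟨B, mem_powerset.1 hBS, hBne, hB0, fun B' hB' hB'ne hB'0 => ?_⟩
  have hB'𝒵 : B' ∈ 𝒵 := mem_filter.2 ⟨mem_powerset.2 (hB'.1.trans (mem_powerset.1 hBS)), hB'ne, hB'0⟩
  have := hmin B' hB'𝒵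
  have := card_lt_card hB'
  omega

/-- **Decomposition into minimal zero-sum blocks**: a zero-sum finite set is labelled so that every label class is a minimal
zero-sum set. [folklore] -/
theorem exists_minZero_labels (w : α → M) :
    ∀ (N : ℕ) (S : Finset α), S.card ≤ N → ∑ x ∈ S, w x = 0 →
      ∃ blk : α → ℕ, ∀ x ∈ S, (S.filter fun y => blk y = blk x).Nonempty ∧
        ∑ y ∈ (S.filter fun y => blk y = blk x), w y = 0 ∧
        ∀ B' ⊂ (S.filter fun y => blk y = blk x), B'.Nonempty → ∑ y ∈ B', w y ≠ 0 := by
  intro N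
  induction N with
  | zero =>
    intro S hS _
    have : S = ∅ := card_eq_zero.1 (Nat.le_zero.1 hS)
    exact ⟨fun _ => 0, fun x hx => by rw [this] at hx; exact absurd hx (notMem_empty x)⟩
  | succ N ih =>
    intro S hS h0
    rcases S.eq_empty_or_nonempty with rfl | hne
    · exact ⟨fun _ => 0, fun x hx => absurd hx (notMem_empty x)⟩
    obtain ⟨B, hBS, hBne, hB0, hBmin⟩ := exists_minZero_subset w hne h0
    have hcardB : 0 < B.card := card_pos.2 hBne
    have hrest0 : ∑ x ∈ S \ B, w x = 0 := by
      have := sum_sdiff hBS (f := w)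
      rw [h0, hB0, add_zero] at this
      exact this
    have hcard' : (S \ B).card ≤ N := by
      rw [card_sdiff_of_subset hBS]; omega
    obtain ⟨blk', hblk'⟩ := ih (S \ B) hcard' hrest0
    set L : ℕ := (S \ B).sup blk' + 1 with hL
    have hlt : ∀ y ∈ S \ B, blk' y < L := fun y hy => Nat.lt_succ_of_le (le_sup (f := blk') hy)
    refine ⟨fun y => if y ∈ B then L else blk' y, fun x hx => ?_⟩
    by_cases hxB : x ∈ B
    · have hcls : S.filter (fun y => (if y ∈ B then L else blk' y) = if x ∈ B then L else blk' x) = B := by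
        ext y
        simp only [mem_filter, if_pos hxB]
        constructor
        · rintro ⟨hyS, hy⟩
          by_contra hyB
          rw [if_neg hyB] at hy
          exact absurd hy (ne_of_lt (hlt y (mem_sdiff.2 ⟨hyS, hyB⟩)))
        · intro hyB
          exact ⟨hBS hyB, by rw [if_pos hyB]⟩
      rw [hcls]; exact ⟨hBne, hB0, hBmin⟩
    · have hxS' : x ∈ S \ B := mem_sdiff.2 ⟨hx, hxB⟩
      have hcls : S.filter (fun y => (if y ∈ B then L else blk' y) = if x ∈ B then L else blk' x) =
          (S \ B).filter (fun y => blk' y = blk' x) := by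
        ext y
        simp only [mem_filter, mem_sdiff, if_neg hxB]
        constructor
        · rintro ⟨hyS, hy⟩
          by_cases hyB : y ∈ B
          · rw [if_pos hyB] at hy; exact absurd hy.symm (ne_of_lt (hlt x hxS'))
          · rw [if_neg hyB] at hy; exact ⟨⟨hyS, hyB⟩, hy⟩
        · rintro ⟨⟨hyS, hyB⟩, hy⟩
          exact ⟨hyS, by rw [if_neg hyB]; exact hy⟩
      rw [hcls]; exact hblk' x hxS'

/-! ### The matching lemma -/

variable {ι : Type} [Fintype ι]

/-- **THE MATCHING LEMMA** (see the module docstring for the setting). [folklore; cite: KarninShpilka2009 §3 (rank-distance clustering)] -/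
theorem matching (Δ₂ : (ι ⊕ ι) → (ι ⊕ ι) → ℕ) (w : ι ⊕ ι → M) (R θ : ℕ)
    (hsymm : ∀ x y, Δ₂ x y = Δ₂ y x) (htri : ∀ x y z, Δ₂ x z ≤ Δ₂ x y + Δ₂ y z) (hrefl : ∀ x, Δ₂ x x = 0)
    (hinv : ∀ i j : ι, Δ₂ (Sum.inr i) (Sum.inr j) = Δ₂ (Sum.inl i) (Sum.inl j))
    (hsum : ∑ x, w x = 0)
    (hminl : ∀ I : Finset ι, I.Nonempty → ∑ i ∈ I, w (Sum.inl i) ≠ 0)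
    (hminr : ∀ J : Finset ι, J.Nonempty → ∑ j ∈ J, w (Sum.inr j) ≠ 0)
    (hRBC : ∀ B : Finset (ι ⊕ ι), B.Nonempty → ∑ x ∈ B, w x = 0 →
      (∀ B' ⊂ B, B'.Nonempty → ∑ x ∈ B', w x ≠ 0) → ∀ x ∈ B, ∀ y ∈ B, Δ₂ x y ≤ R)
    (hgood : ∀ i j : ι, Δ₂ (Sum.inl i) (Sum.inl j) ≤ 2 * R + 2 * (Fintype.card ι - 1) * θ →
      Relation.ReflTransGen (fun a b : ι => Δ₂ (Sum.inl a) (Sum.inl b) ≤ θ) i j) :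
    ∃ e : ι → ι,
      (∀ i, ∑ i' ∈ univ.filter (fun i' => Relation.ReflTransGen (fun a b : ι => Δ₂ (Sum.inl a) (Sum.inl b) ≤ θ) i i'),
            w (Sum.inl i') +
          ∑ j ∈ univ.filter (fun j => Relation.ReflTransGen (fun a b : ι => Δ₂ (Sum.inl a) (Sum.inl b) ≤ θ) (e i) j),
            w (Sum.inr j) = 0) ∧
      (∀ i i', Relation.ReflTransGen (fun a b : ι => Δ₂ (Sum.inl a) (Sum.inl b) ≤ θ) i i' ↔
        Relation.ReflTransGen (fun a b : ι => Δ₂ (Sum.inl a) (Sum.inl b) ≤ θ) (e i) (e i')) ∧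
      (∀ j, ∃ i, Relation.ReflTransGen (fun a b : ι => Δ₂ (Sum.inl a) (Sum.inl b) ≤ θ) (e i) j) := by
  set Δ : ι → ι → ℕ := fun a b => Δ₂ (Sum.inl a) (Sum.inl b) with hΔ
  have hΔtri : ∀ i j l, Δ i l ≤ Δ i j + Δ j l := fun i j l => htri _ _ _
  have hΔrefl : ∀ i, Δ i i = 0 := fun i => hrefl _
  -- blocks
  obtain ⟨blk, hblk⟩ := exists_minZero_labels w (Fintype.card (ι ⊕ ι)) univ (by rw [card_univ])
    (by simpa using hsum)
  set fib : ι ⊕ ι → Finset (ι ⊕ ι) := fun x => univ.filter fun y => blk y = blk x with hfib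
  have hmemfib : ∀ x, x ∈ fib x := fun x => mem_filter.2 ⟨mem_univ x, rfl⟩
  have hfib_eq : ∀ x y, y ∈ fib x → fib y = fib x := by
    intro x y hy
    have hyx : blk y = blk x := (mem_filter.1 hy).2
    ext z; simp only [hfib, mem_filter, mem_univ, true_and, hyx]
  have hfib0 : ∀ x, ∑ y ∈ fib x, w y = 0 := fun x => (hblk x (mem_univ x)).2.1
  have hR : ∀ x y, y ∈ fib x → Δ₂ x y ≤ R := fun x y hy =>
    hRBC _ (hblk x (mem_univ x)).1 (hfib0 x) (hblk x (mem_univ x)).2.2 x (hmemfib x) y hy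
  -- every block meets both sides
  have hmeet_r : ∀ i, ∃ j, Sum.inr j ∈ fib (Sum.inl i) := by
    intro i
    by_contra hno'
    have hno : ∀ j, Sum.inr j ∉ fib (Sum.inl i) := fun j h => hno' ⟨j, h⟩
    set I := univ.filter fun i' : ι => Sum.inl i' ∈ fib (Sum.inl i) with hI
    have hIne : I.Nonempty := ⟨i, mem_filter.2 ⟨mem_univ i, hmemfib _⟩⟩
    apply hminl I hIne
    rw [← hfib0 (Sum.inl i)]
    symm
    refine Finset.sum_bij' (fun x _ => Sum.elim id (fun _ => i) x) (fun i' _ => Sum.inl i') ?_ ?_ ?_ ?_ ?_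
    · intro x hx
      rcases x with i' | j
      · exact mem_filter.2 ⟨mem_univ _, hx⟩
      · exact absurd hx (hno j)
    · intro i' hi'; exact (mem_filter.1 hi').2
    · intro x hx
      rcases x with i' | j
      · rfl
      · exact absurd hx (hno j)
    · intro i' _; rfl
    · intro x hx
      rcases x with i' | j
      · rfl
      · exact absurd hx (hno j)
  have hmeet_l : ∀ j, ∃ i, Sum.inl i ∈ fib (Sum.inr j) := by
    intro j
    by_contra hno'
    have hno : ∀ i, Sum.inl i ∉ fib (Sum.inr j) := fun i h => hno' ⟨i, h⟩
    set J := univ.filter fun j' : ι => Sum.inr j' ∈ fib (Sum.inr j) with hJ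
    have hJne : J.Nonempty := ⟨j, mem_filter.2 ⟨mem_univ j, hmemfib _⟩⟩
    apply hminr J hJne
    rw [← hfib0 (Sum.inr j)]
    symm
    refine Finset.sum_bij' (fun x _ => Sum.elim (fun _ => j) id x) (fun j' _ => Sum.inr j') ?_ ?_ ?_ ?_ ?_
    · intro x hx
      rcases x with i | j'
      · exact absurd hx (hno i)
      · exact mem_filter.2 ⟨mem_univ _, hx⟩
    · intro j' hj'; exact (mem_filter.1 hj').2
    · intro x hx
      rcases x with i | j'
      · exact absurd hx (hno i)
      · rfl
    · intro j' _; rfl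
    · intro x hx
      rcases x with i | j'
      · exact absurd hx (hno i)
      · rfl
  choose e he using hmeet_r
  -- diameter of clusters
  have hD : ∀ i i', Relation.ReflTransGen (fun a b => Δ a b ≤ θ) i i' → Δ i i' ≤ (Fintype.card ι - 1) * θ :=
    fun i i' h => dist_le_of_linked Δ hΔtri hΔrefl h
  -- KEY ESTIMATES
  have hkey_l : ∀ i i' j j', Sum.inr j ∈ fib (Sum.inl i) → Sum.inr j' ∈ fib (Sum.inl i') →
      Relation.ReflTransGen (fun a b => Δ a b ≤ θ) j j' → Relation.ReflTransGen (fun a b => Δ a b ≤ θ) i i' := by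
    intro i i' j j' hj hj' hjj'
    refine hgood i i' ?_
    calc Δ₂ (Sum.inl i) (Sum.inl i')
        ≤ Δ₂ (Sum.inl i) (Sum.inr j) + Δ₂ (Sum.inr j) (Sum.inl i') := htri _ _ _
      _ ≤ Δ₂ (Sum.inl i) (Sum.inr j) + (Δ₂ (Sum.inr j) (Sum.inr j') + Δ₂ (Sum.inr j') (Sum.inl i')) :=
          Nat.add_le_add_left (htri _ _ _) _
      _ ≤ R + ((Fintype.card ι - 1) * θ + R) := by
          refine Nat.add_le_add (hR _ _ hj) (Nat.add_le_add ?_ ?_)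
          · rw [hinv]; exact hD j j' hjj'
          · rw [hsymm]; exact hR _ _ hj'
      _ ≤ 2 * R + 2 * (Fintype.card ι - 1) * θ := by nlinarith
  have hkey_r : ∀ i i' j j', Sum.inr j ∈ fib (Sum.inl i) → Sum.inr j' ∈ fib (Sum.inl i') →
      Relation.ReflTransGen (fun a b => Δ a b ≤ θ) i i' → Relation.ReflTransGen (fun a b => Δ a b ≤ θ) j j' := by
    intro i i' j j' hj hj' hii'
    refine hgood j j' ?_
    calc Δ₂ (Sum.inl j) (Sum.inl j') = Δ₂ (Sum.inr j) (Sum.inr j') := (hinv j j').symm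
      _ ≤ Δ₂ (Sum.inr j) (Sum.inl i) + Δ₂ (Sum.inl i) (Sum.inr j') := htri _ _ _
      _ ≤ Δ₂ (Sum.inr j) (Sum.inl i) + (Δ₂ (Sum.inl i) (Sum.inl i') + Δ₂ (Sum.inl i') (Sum.inr j')) :=
          Nat.add_le_add_left (htri _ _ _) _
      _ ≤ R + ((Fintype.card ι - 1) * θ + R) := by
          refine Nat.add_le_add (by rw [hsymm]; exact hR _ _ hj) (Nat.add_le_add (hD i i' hii') (hR _ _ hj'))
      _ ≤ 2 * R + 2 * (Fintype.card ι - 1) * θ := by nlinarith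
  refine ⟨e, fun i => ?_, fun i i' => ⟨fun h => hkey_r i i' _ _ (he i) (he i') h,
    fun h => hkey_l i i' _ _ (he i) (he i') h⟩, fun j => ?_⟩
  · -- the matched pair of clusters is a union of blocks, hence sums to zero
    set Ci := univ.filter (fun i' => Relation.ReflTransGen (fun a b => Δ a b ≤ θ) i i') with hCi
    set Cj := univ.filter (fun j => Relation.ReflTransGen (fun a b => Δ a b ≤ θ) (e i) j) with hCj
    set Z : Finset (ι ⊕ ι) := Ci.map ⟨Sum.inl, Sum.inl_injective⟩ ∪ Cj.map ⟨Sum.inr, Sum.inr_injective⟩ with hZ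
    have hmemZ_l : ∀ i', Sum.inl i' ∈ Z ↔ Relation.ReflTransGen (fun a b => Δ a b ≤ θ) i i' := by
      intro i'
      simp only [hZ, hCi, mem_union, mem_map, Function.Embedding.coeFn_mk, mem_filter, mem_univ, true_and,
        Sum.inl.injEq, exists_eq_right, reduceCtorEq, and_false, exists_false, or_false]
    have hmemZ_r : ∀ j, Sum.inr j ∈ Z ↔ Relation.ReflTransGen (fun a b => Δ a b ≤ θ) (e i) j := by
      intro j
      simp only [hZ, hCj, mem_union, mem_map, Function.Embedding.coeFn_mk, mem_filter, mem_univ, true_and,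
        Sum.inr.injEq, exists_eq_right, reduceCtorEq, and_false, exists_false, false_or]
    have hclosed : ∀ x ∈ Z, ∀ y ∈ fib x, y ∈ Z := by
      intro x hx y hy
      rcases x with i₁ | j₁ <;> rcases y with i₂ | j₂
      · rw [hmemZ_l] at hx ⊢
        exact Relation.ReflTransGen.trans hx (hgood i₁ i₂ ((hR _ _ hy).trans (by nlinarith)))
      · rw [hmemZ_l] at hx; rw [hmemZ_r]
        exact hkey_r i i₁ _ _ (he i) hy hx
      · rw [hmemZ_r] at hx; rw [hmemZ_l]
        have hy' : Sum.inr j₁ ∈ fib (Sum.inl i₂) := by rw [hfib_eq _ _ hy]; exact hmemfib _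
        exact hkey_l i i₂ _ _ (he i) hy' hx
      · rw [hmemZ_r] at hx ⊢
        refine Relation.ReflTransGen.trans hx (hgood j₁ j₂ ?_)
        calc Δ₂ (Sum.inl j₁) (Sum.inl j₂) = Δ₂ (Sum.inr j₁) (Sum.inr j₂) := (hinv _ _).symm
          _ ≤ R := hR _ _ hy
          _ ≤ _ := by nlinarith
    have hsumZ : ∑ x ∈ Z, w x = 0 := by
      rw [← sum_fiberwise_of_maps_to (s := Z) (t := Z.image blk) (g := blk) (f := w) fun x hx => mem_image_of_mem _ hx]
      refine sum_eq_zero fun l hl => ?_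
      obtain ⟨x, hx, rfl⟩ := mem_image.1 hl
      have hfilt : Z.filter (fun y => blk y = blk x) = fib x := by
        ext y
        simp only [mem_filter, hfib, mem_univ, true_and]
        exact ⟨fun h => h.2, fun h => ⟨hclosed x hx y (mem_filter.2 ⟨mem_univ y, h⟩), h⟩⟩
      rw [hfilt]
      exact hfib0 x
    rw [hZ, sum_union, sum_map, sum_map] at hsumZ
    · exact hsumZ
    · rw [disjoint_left]
      intro x hx1 hx2
      obtain ⟨a, -, rfl⟩ := mem_map.1 hx1
      obtain ⟨b, -, hb⟩ := mem_map.1 hx2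
      exact Sum.inr_ne_inl hb
  · obtain ⟨i, hi⟩ := hmeet_l j
    refine ⟨i, hgood (e i) j ?_⟩
    have h1 : fib (Sum.inl i) = fib (Sum.inr j) := hfib_eq _ _ hi
    have h2 : Sum.inr (e i) ∈ fib (Sum.inr j) := h1 ▸ he i
    calc Δ₂ (Sum.inl (e i)) (Sum.inl j) = Δ₂ (Sum.inr (e i)) (Sum.inr j) := (hinv _ _).symm
      _ ≤ R := by rw [hsymm]; exact hR _ _ h2
      _ ≤ _ := by nlinarith

end RankClustering

end Summit.ValiantsHypothesis.ValiantsHypothesis.Theorems
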